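import Summits.BirchSwinnertonDyer.BirchSwinnertonDyer.Theorems.EisensteinPrimesGoodLatticeResidualPairDeterminant
import Literature.NumberTheory.EllipticCurves.OpenImageMazurFrobeniusProofs
import Summits.BirchSwinnertonDyer.BirchSwinnertonDyer.Theorems.EisensteinPrimesGoodLatticeAnacongEulerCompMultiplicative
import Literature.NumberTheory.EllipticCurves.LFunctionPrimeCoeff
import Summits.BirchSwinnertonDyer.BirchSwinnertonDyer.Theorems.EisensteinPrimesGoodLatticeResidualPairScalarsAtMultiplicativeAll
import Summits.BirchSwinnertonDyer.BirchSwinnertonDyer.Theorems.EisensteinPrimesResidualPairUnramifiedAtMultiplicative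
import Literature.NumberTheory.EllipticCurves.RootNumberAtkinLehnerSemistableProofs
import HarnessLib

/-!
# Kriz's placement dichotomy at a multiplicative prime for the quotient Teichmüller character over `ℚ`
# (`a_ℓ ≡ φ̃(ℓ)` for every Frobenius value, or `a_ℓ ≡ φ̃(ℓ)⁻¹ℓ` for every Frobenius value — Kriz 2016 Thm. 34 (2), `E/ℚ`, `k = 2`)
# (cell `bsd-eis`, width seat `bsd-line-x1-p1-w2` gen 26; helper for crux 2 `GoodLatticeBDPValue`, `--supports stmt-BirchSwinnertonDyer-19032`)

WHY. Input of the construction of a full-Eisenstein-descent TYPE from the full-descent datum (companion file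
`EisensteinPrimesGoodLatticeKrizDescentTypeOfDatum.lean`), which feeds the named fact
`CastellaGrossiLeeSkinner2022.proofThm221_congruence_of_fullEisensteinDescent` (CGLS 2022's proof of Thm. 2.2.1 from (eq:cong-mf)) and
its kernel consumer `GoodLatticeAnacongOfCGLSProofThm221.anacong_of_proofThm221_of_thmI` (content stub 3a-A of crux 2).
* §1 `zsmul_eq_zsmul_of_intCast_eq`, `exists_natScalars` — ℕ-scalars of any `σ ∈ Γ_ℚ` on a rational `p`-line `Φ` and on `E[p]/Φ` from
  the Teichmüller data, congruent to `θsub(σ)`, `θquot(σ)` (the input format of the tree's Frobenius-scalar dichotomies).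
* §2 `norm_sub_intCast_lt_one_of_zmod_eq`, `isResidualPairOver_rat`, **`placement_dichotomy_rat`** — at a multiplicative `ℓ ≠ p`
  with place `v`: `θquot` is unramified at `v` and EITHER `‖a_ℓ − a‖ < 1` for every `a` with `θquot.HasFrobCharpolyAt v (X − a)` OR
  `‖a_ℓ − a⁻¹ℓ‖ < 1` for every such `a` (`a_ℓ = WeierstrassCurve.LFunction W ℓ = ±1`); from the tree's dichotomies
  `LineScalarsAtMultiplicativePlace.exists_frob_lineScalars_of_hasSplitMultiplicativeReductionAt` (`{(ℓ,1),(1,ℓ)}`) and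
  `GoodLatticeResidualPairScalarsAtMultiplicativeAll.exists_frob_lineScalars_of_not_hasSplitMultiplicativeReductionAtPrime'`
  (`{(−ℓ,−1),(−1,−ℓ)}`) and `ResidualPairUnramifiedAtMultiplicative.isUnramifiedAt_of_hasMultiplicativeReductionAt` over `ℚ`.

HONEST FRAMING: helper theorems (0 definitions, 0 named facts, 0 sorry); closes no stub; no summit statement / crux / BSD is proved
here. References: [Kriz2016] Thm. 34 (2)(3); [GreenbergVatsal2000] §2 pp. 14–15; [SilvermanAEC2009] §C.16; [SerreInventiones1972] §1.12;
[KellerYin2024] §1.4 (arXiv:2402.12781v2 TeX L1063–1086).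
-/

set_option autoImplicit false
set_option linter.dupNamespace false

noncomputable section

open scoped Classical

open WeierstrassCurve NumberField IsDedekindDomain Field
  Literature.NumberTheory.EllipticCurves Literature.NumberTheory.EllipticCurves.Rank1Residual
  Literature.NumberTheory.GaloisRepresentations
  Literature.NumberTheory.EllipticCurves.GreenbergSelmer
  Literature.NumberTheory.EllipticCurves.KellerYin2024

namespace Summit.BirchSwinnertonDyer.BirchSwinnertonDyer.Theorems.GoodLatticeKrizPlacementDichotomyRat

variable {p : ℕ} [hp : Fact p.Prime] {S : Set (PadicAlgCl p)}

/-! ## §1 ℕ-scalars of a Galois element on the line and on the quotient, from the Teichmüller data -/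

/-- `a • x = b • x` for `x` killed by `p` and `a ≡ b (mod p)`. [folklore] -/
theorem zsmul_eq_zsmul_of_intCast_eq {M : Type*} [AddCommGroup M] {x : M} (hx : (p : ℤ) • x = 0) {a b : ℤ}
    (h : (a : ZMod p) = (b : ZMod p)) : a • x = b • x := by
  obtain ⟨k, hk⟩ := (ZMod.intCast_eq_intCast_iff_dvd_sub b a p).mp h.symm
  have : a = b + p * k := by linarith
  rw [this, add_zsmul, mul_comm, mul_zsmul, hx, zsmul_zero, add_zero]

/-- **ℕ-scalars on the line and the quotient.** For a rational `p`-line `Φ` with Teichmüller lifts `θsub` (on `Φ`) and `θquot`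
(on `E[p]/Φ`) and any `σ ∈ Γ_ℚ`: natural numbers `nφ, nψ` with `σP = nφ P` on `Φ`, `σQ − nψ Q ∈ Φ` on `E[p]` (as elements of the
`p`-torsion), `nφ ≡ θsub(σ)`, `nψ ≡ θquot(σ) (mod 𝔭)` — the input format of the tree's Frobenius-scalar dichotomies at multiplicative
primes. [cite: KellerYin2024, §1.4 (arXiv:2402.12781v2 TeX L1063–1086)] [cite: GreenbergVatsal2000, §2 pp. 14–15] -/
theorem exists_natScalars (W : WeierstrassCurve ℚ) {Φ : AddSubgroup (geomTorsion W (p : ℤ))}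
    {θsub θquot : FramedGaloisRep ℚ (padicCoeffIntegers S) 1}
    (hsub : IsTeichmullerLiftOn S (Φ.map (geomTorsion W (p : ℤ)).subtype) θsub)
    (hquot : IsTeichmullerLiftOnQuot S (Φ.map (geomTorsion W (p : ℤ)).subtype) (geomTorsion W (p : ℤ)) θquot)
    (σ : absoluteGaloisGroup ℚ) :
    ∃ nφ nψ : ℕ, (∀ P ∈ Φ, σ • P = nφ • P) ∧ (∀ Q : geomTorsion W (p : ℤ), σ • Q - nψ • Q ∈ Φ) ∧
      ‖((KellerYin2024.entry S θsub σ : padicCoeffIntegers S) : PadicAlgCl p) - ((nφ : ℤ) : PadicAlgCl p)‖ < 1 ∧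
      ‖((KellerYin2024.entry S θquot σ : padicCoeffIntegers S) : PadicAlgCl p) - ((nψ : ℤ) : PadicAlgCl p)‖ < 1 := by
  haveI : NeZero p := ⟨hp.out.ne_zero⟩
  obtain ⟨a, ha, haΦ⟩ := hsub.exists_smul_eq σ
  obtain ⟨b, hb, hbΦ⟩ := hquot.2 σ
  refine ⟨(a : ZMod p).val, (b : ZMod p).val, ?_, ?_, ?_, ?_⟩
  · intro P hP
    apply Subtype.ext
    have h1 := haΦ (P : geomPoints W) ⟨P, hP, rfl⟩
    rw [AddSubgroup.torsionBy.coe_smul, h1, AddSubgroupClass.coe_nsmul, ← natCast_zsmul]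
    refine zsmul_eq_zsmul_of_intCast_eq (p := p) ?_ ?_
    · have := (mem_geomTorsion_iff W (p : ℤ) (P : geomPoints W)).mp P.2
      exact this
    · rw [Int.cast_natCast, ZMod.natCast_zmod_val]
  · intro Q
    obtain ⟨T, hT, hTeq⟩ := AddSubgroup.mem_map.mp (hbΦ (Q : geomPoints W) Q.2)
    have hT' : T = σ • Q - ((b : ZMod p).val : ℕ) • Q := by
      apply Subtype.ext
      rw [AddSubgroupClass.coe_sub, AddSubgroup.torsionBy.coe_smul, AddSubgroupClass.coe_nsmul, ← natCast_zsmul,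
        ← zsmul_eq_zsmul_of_intCast_eq (p := p) ((mem_geomTorsion_iff W (p : ℤ) (Q : geomPoints W)).mp Q.2)
          (show (b : ZMod p) = (((b : ZMod p).val : ℕ) : ℤ) by rw [Int.cast_natCast, ZMod.natCast_zmod_val])]
      exact hTeq
    rw [← hT']; exact hT
  · rw [Int.cast_natCast]
    have e : ((KellerYin2024.entry S θsub σ : padicCoeffIntegers S) : PadicAlgCl p) - (((a : ZMod p).val : ℕ) : PadicAlgCl p) =
        (((KellerYin2024.entry S θsub σ : padicCoeffIntegers S) : PadicAlgCl p) - (a : PadicAlgCl p)) +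
          ((a : PadicAlgCl p) - (((a : ZMod p).val : ℕ) : PadicAlgCl p)) := by ring
    rw [e]
    refine (IsUltrametricDist.norm_add_le_max _ _).trans_lt (max_lt ha ?_)
    rw [show (a : PadicAlgCl p) - (((a : ZMod p).val : ℕ) : PadicAlgCl p) = (((a - ((a : ZMod p).val : ℕ) : ℤ) : ℚ_[p]) : PadicAlgCl p)
        by push_cast; rfl, PadicAlgCl.norm_extends, Padic.norm_intCast_lt_one_iff, ← ZMod.intCast_zmod_eq_zero_iff_dvd]
    push_cast
    rw [ZMod.natCast_zmod_val, sub_self]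
  · rw [Int.cast_natCast]
    have e : ((KellerYin2024.entry S θquot σ : padicCoeffIntegers S) : PadicAlgCl p) - (((b : ZMod p).val : ℕ) : PadicAlgCl p) =
        (((KellerYin2024.entry S θquot σ : padicCoeffIntegers S) : PadicAlgCl p) - (b : PadicAlgCl p)) +
          ((b : PadicAlgCl p) - (((b : ZMod p).val : ℕ) : PadicAlgCl p)) := by ring
    rw [e]
    refine (IsUltrametricDist.norm_add_le_max _ _).trans_lt (max_lt hb ?_)
    rw [show (b : PadicAlgCl p) - (((b : ZMod p).val : ℕ) : PadicAlgCl p) = (((b - ((b : ZMod p).val : ℕ) : ℤ) : ℚ_[p]) : PadicAlgCl p)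
        by push_cast; rfl, PadicAlgCl.norm_extends, Padic.norm_intCast_lt_one_iff, ← ZMod.intCast_zmod_eq_zero_iff_dvd]
    push_cast
    rw [ZMod.natCast_zmod_val, sub_self]

/-! ## §2 One multiplicative prime: unramifiedness and the placement dichotomy for `θquot` over `ℚ` -/

/-- Moving an integer approximation along a congruence mod `p`. [folklore] -/
theorem norm_sub_intCast_lt_one_of_zmod_eq {x : PadicAlgCl p} {n m : ℤ} (hx : ‖x - (n : PadicAlgCl p)‖ < 1)
    (h : (n : ZMod p) = (m : ZMod p)) : ‖x - (m : PadicAlgCl p)‖ < 1 := by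
  have hnm : ‖(n : PadicAlgCl p) - (m : PadicAlgCl p)‖ < 1 := by
    rw [show (n : PadicAlgCl p) - (m : PadicAlgCl p) = (((n - m : ℤ) : ℚ_[p]) : PadicAlgCl p) by push_cast; rfl,
      PadicAlgCl.norm_extends, Padic.norm_intCast_lt_one_iff, ← ZMod.intCast_eq_intCast_iff_dvd_sub]
    exact h.symm
  have e : x - (m : PadicAlgCl p) = (x - (n : PadicAlgCl p)) + ((n : PadicAlgCl p) - (m : PadicAlgCl p)) := by ring
  rw [e]
  exact (IsUltrametricDist.norm_add_le_max _ _).trans_lt (max_lt hx hnm)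

/-- The residual pair over `ℚ` packaged from the Teichmüller data on a rational line. [cite: KellerYin2024, §1.4 (arXiv:2402.12781v2)] -/
theorem isResidualPairOver_rat (W : WeierstrassCurve ℚ) {Φ : AddSubgroup (geomTorsion W (p : ℤ))} (hΦ : IsRationalLine W p Φ)
    {θsub θquot : FramedGaloisRep ℚ (padicCoeffIntegers S) 1}
    (hsub : IsTeichmullerLiftOn S (Φ.map (geomTorsion W (p : ℤ)).subtype) θsub)
    (hquot : IsTeichmullerLiftOnQuot S (Φ.map (geomTorsion W (p : ℤ)).subtype) (geomTorsion W (p : ℤ)) θquot) :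
    IsResidualPairOver W p θsub θquot := by
  have hcardΦ : Nat.card (Φ.map (geomTorsion W (p : ℤ)).subtype) = p := by
    rw [Nat.card_congr (Φ.equivMapOfInjective (geomTorsion W (p : ℤ)).subtype
      (geomTorsion W (p : ℤ)).subtype_injective).toEquiv.symm, hΦ.1]
  refine isResidualPairOver_of_isTeichmullerLift hcardΦ (AddSubgroup.map_subtype_le _) ?_ hsub hquot
  rintro σ _ ⟨R, hR, rfl⟩
  exact ⟨σ • R, hΦ.2 σ R hR, rfl⟩

/-- **Placement dichotomy at a multiplicative prime `ℓ ≠ p` (Kriz Thm. 34 (2), E/ℚ, `k = 2`):** `θquot` is unramified at the place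
`v ∋ ℓ`, and EITHER every Frobenius value `a` of `θquot` at `v` satisfies `a_ℓ ≡ a` (so `ℓ` may be placed in `N₊`) OR every such `a`
satisfies `a_ℓ ≡ a⁻¹ℓ` (`ℓ` may be placed in `N₋`), `a_ℓ = ±1 = WeierstrassCurve.LFunction W ℓ` (tree's Frobenius-scalar dichotomy
`{(εℓ, ε), (ε, εℓ)}` over `ℚ`). [cite: Kriz2016, Thm. 34 (2)(3)] [cite: GreenbergVatsal2000, §2 pp. 14–15] -/
theorem placement_dichotomy_rat (W : WeierstrassCurve ℚ) [W.IsElliptic] [W.IsGloballyMinimal]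
    {Φ : AddSubgroup (geomTorsion W (p : ℤ))} (hΦ : IsRationalLine W p Φ)
    {θsub θquot : FramedGaloisRep ℚ (padicCoeffIntegers S) 1}
    (hsub : IsTeichmullerLiftOn S (Φ.map (geomTorsion W (p : ℤ)).subtype) θsub)
    (hquot : IsTeichmullerLiftOnQuot S (Φ.map (geomTorsion W (p : ℤ)).subtype) (geomTorsion W (p : ℤ)) θquot)
    {ℓ : ℕ} [hℓ : Fact ℓ.Prime] (hℓp : ℓ ≠ p) (hmult : W.HasMultiplicativeReductionAtPrime ℓ)
    {v : HeightOneSpectrum (𝓞 ℚ)} (hv : ((ℓ : ℕ) : 𝓞 ℚ) ∈ v.asIdeal) :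
    θquot.IsUnramifiedAt v ∧
      ((∀ a : padicCoeffIntegers S, θquot.HasFrobCharpolyAt v (Polynomial.X - Polynomial.C a) →
          ‖((W.LFunction ℓ : ℤ) : PadicAlgCl p) - (a : PadicAlgCl p)‖ < 1) ∨
        (∀ a : padicCoeffIntegers S, θquot.HasFrobCharpolyAt v (Polynomial.X - Polynomial.C a) →
          ‖((W.LFunction ℓ : ℤ) : PadicAlgCl p) - (a : PadicAlgCl p)⁻¹ * (ℓ : PadicAlgCl p)‖ < 1)) := by
  have hpp := hp.out
  have hvℓ : ((Rat.HeightOneSpectrum.primesEquiv v : Nat.Primes) : ℕ) = ℓ :=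
    Rat.HeightOneSpectrum.primesEquiv_eq_of_natCast_mem _ hℓ.out hv
  have hmultv : W.HasMultiplicativeReductionAt v :=
    Summit.BirchSwinnertonDyer.Rank1Residual.X2.GreenbergVatsalStrictSelmerMultiplicative.hasMultiplicativeReductionAt_of_mem
      W ℓ hmult hv
  have hpv : ((p : ℕ) : 𝓞 ℚ) ∉ v.asIdeal :=
    ResidualPairUnramifiedAtMultiplicative.not_natCast_mem_of_natCast_mem_of_ne hℓ.out hpp hℓp hv
  have hpairQ := isResidualPairOver_rat W hΦ hsub hquot
  have hunr : θquot.IsUnramifiedAt v :=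
    (ResidualPairUnramifiedAtMultiplicative.isUnramifiedAt_of_hasMultiplicativeReductionAt W hpairQ hmultv hpv).2
  refine ⟨hunr, ?_⟩
  have hℓ0 : (ℓ : ZMod p) ≠ 0 := by
    rw [Ne, ZMod.natCast_eq_zero_iff]
    exact fun h' ↦ hℓp ((Nat.prime_dvd_prime_iff_eq hpp hℓ.out).mp h').symm
  -- norms: `ℓ` is a unit, values are integral
  have hℓnorm : ‖(ℓ : PadicAlgCl p)‖ = 1 := by
    rw [show (ℓ : PadicAlgCl p) = (((ℓ : ℤ) : ℚ_[p]) : PadicAlgCl p) by push_cast; rfl, PadicAlgCl.norm_extends]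
    refine le_antisymm (Padic.norm_int_le_one _) (not_lt.mp fun hlt ↦ hℓ0 ?_)
    rw [Padic.norm_intCast_lt_one_iff] at hlt
    have : ((ℓ : ℤ) : ZMod p) = 0 := by rw [ZMod.intCast_zmod_eq_zero_iff_dvd]; exact hlt
    rwa [Int.cast_natCast] at this
  -- the scalar `nψ` of a Frobenius `σ₁` determines every Frobenius value `a` of `θquot` at `v`
  have hval : ∀ {𝔓 : Ideal (absIntegers (𝓞 ℚ) ℚ)}, 𝔓 ∈ v.primesAbove → ∀ {σ₁ : absoluteGaloisGroup ℚ},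
      IsArithFrobAt (𝓞 ℚ) σ₁ 𝔓 → ∀ {a : padicCoeffIntegers S}, θquot.HasFrobCharpolyAt v (Polynomial.X - Polynomial.C a) →
      KellerYin2024.entry S θquot σ₁ = a := by
    intro 𝔓 h𝔓 σ₁ hσ₁ a ha
    have h := ha 𝔓 h𝔓 σ₁ hσ₁
    rw [GoodLatticeAnacongEulerCompMultiplicative.charpoly_eq_X_sub_C_entry] at h
    rwa [sub_right_inj, Polynomial.C_inj] at h
  -- `a ≡ ℓ` (or `−ℓ`) gives the `N₋` congruence `a⁻¹ℓ ≡ 1` (or `−1`)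
  have hinv : ∀ {a : padicCoeffIntegers S} {e : ℤ}, (e = 1 ∨ e = -1) →
      ‖(a : PadicAlgCl p) - ((e * ℓ : ℤ) : PadicAlgCl p)‖ < 1 →
      ‖(e : PadicAlgCl p) - (a : PadicAlgCl p)⁻¹ * (ℓ : PadicAlgCl p)‖ < 1 := by
    intro a e he h
    have henorm : ‖(e : PadicAlgCl p)‖ = 1 := by
      rcases he with rfl | rfl
      · rw [Int.cast_one, norm_one]
      · rw [Int.cast_neg, Int.cast_one, norm_neg, norm_one]
    have heℓ : ‖((e * ℓ : ℤ) : PadicAlgCl p)‖ = 1 := by rw [Int.cast_mul, Int.cast_natCast, norm_mul, henorm, hℓnorm, one_mul]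
    have hanorm : ‖(a : PadicAlgCl p)‖ = 1 := by
      have e' : (a : PadicAlgCl p) = ((e * ℓ : ℤ) : PadicAlgCl p) + ((a : PadicAlgCl p) - ((e * ℓ : ℤ) : PadicAlgCl p)) := by
        ring
      rw [e', IsUltrametricDist.norm_add_eq_max_of_norm_ne_norm (by rw [heℓ]; exact h.ne'), heℓ, max_eq_left h.le]
    have ha0 : (a : PadicAlgCl p) ≠ 0 := fun h0 ↦ by rw [h0, norm_zero] at hanorm; exact zero_ne_one hanorm
    have he2 : (e : PadicAlgCl p) * (e : PadicAlgCl p) = 1 := by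
      rcases he with rfl | rfl
      · rw [Int.cast_one, one_mul]
      · rw [Int.cast_neg, Int.cast_one, neg_mul_neg, one_mul]
    have e' : (e : PadicAlgCl p) - (a : PadicAlgCl p)⁻¹ * (ℓ : PadicAlgCl p) =
        (a : PadicAlgCl p)⁻¹ * (e : PadicAlgCl p) * ((a : PadicAlgCl p) - ((e * ℓ : ℤ) : PadicAlgCl p)) := by
      push_cast
      field_simp
      linear_combination (ℓ : PadicAlgCl p) * he2
    rw [e', norm_mul, norm_mul, norm_inv, hanorm, henorm, inv_one, one_mul, one_mul]
    exact h
  by_cases hsp : W.HasSplitMultiplicativeReductionAtPrime ℓ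
  · -- SPLIT: `a_ℓ = 1`, scalars `{(ℓ, 1), (1, ℓ)}`
    have hsplitv : W.HasSplitMultiplicativeReductionAt v := by
      refine (WeierstrassCurve.hasSplitMultiplicativeReductionAtPrime_iff_hasSplitMultiplicativeReductionAt W v).mp ?_
      have key : ∀ (q : ℕ) (hq' : Fact q.Prime), q = ℓ → (haveI := hq'; W.HasSplitMultiplicativeReductionAtPrime q) := by
        rintro q hq' rfl; exact hsp
      exact key _ _ hvℓ
    have haℓ : ((W.LFunction ℓ : ℤ) : PadicAlgCl p) = ((1 : ℤ) : PadicAlgCl p) := by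
      rw [← hvℓ, W.LFunction_apply_primesEquiv_of_hasSplitMultiplicativeReductionAt hsplitv]
    obtain ⟨𝔓, h𝔓, σ₁, hσ₁, key⟩ :=
      LineScalarsAtMultiplicativePlace.exists_frob_lineScalars_of_hasSplitMultiplicativeReductionAt (W := W) (p := p) hvℓ hℓp
        hsplitv
    obtain ⟨nφ, nψ, hφ, hψ, -, hnψ⟩ := exists_natScalars W hsub hquot σ₁
    rcases key hΦ hφ hψ with ⟨-, h1⟩ | ⟨-, h1⟩
    · left
      intro a ha
      rw [haℓ, norm_sub_rev, ← hval h𝔓 hσ₁ ha]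
      refine norm_sub_intCast_lt_one_of_zmod_eq hnψ ?_
      rw [Int.cast_natCast, h1, Int.cast_one]
    · right
      intro a ha
      rw [haℓ]
      refine hinv (Or.inl rfl) ?_
      rw [← hval h𝔓 hσ₁ ha]
      refine norm_sub_intCast_lt_one_of_zmod_eq hnψ ?_
      rw [Int.cast_natCast, h1, Int.cast_mul, Int.cast_one, one_mul, Int.cast_natCast]
  · -- NON-SPLIT: `a_ℓ = −1`, scalars `{(−ℓ, −1), (−1, −ℓ)}`
    have hnsv : ¬ W.HasSplitMultiplicativeReductionAt v := by
      intro hsplitv; apply hsp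
      have h' := (WeierstrassCurve.hasSplitMultiplicativeReductionAtPrime_iff_hasSplitMultiplicativeReductionAt W v).mpr hsplitv
      have key : ∀ (q : ℕ) (hq' : Fact q.Prime), q = ℓ →
          (haveI := hq'; W.HasSplitMultiplicativeReductionAtPrime q) → W.HasSplitMultiplicativeReductionAtPrime ℓ := by
        rintro q hq' rfl h''; exact h''
      exact key _ _ hvℓ h'
    have haℓ : ((W.LFunction ℓ : ℤ) : PadicAlgCl p) = ((-1 : ℤ) : PadicAlgCl p) := by
      rw [← hvℓ, W.LFunction_apply_primesEquiv_of_hasMultiplicativeReductionAt_of_not_split hmultv hnsv]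
    obtain ⟨𝔓, h𝔓, σ₁, hσ₁, key⟩ :=
      GoodLatticeResidualPairScalarsAtMultiplicativeAll.exists_frob_lineScalars_of_not_hasSplitMultiplicativeReductionAtPrime'
        (W := W) (p := p) hvℓ hℓp hmult hsp
    obtain ⟨nφ, nψ, hφ, hψ, -, hnψ⟩ := exists_natScalars W hsub hquot σ₁
    rcases key hΦ hφ hψ with ⟨-, h1⟩ | ⟨-, h1⟩
    · left
      intro a ha
      rw [haℓ, norm_sub_rev, ← hval h𝔓 hσ₁ ha]
      refine norm_sub_intCast_lt_one_of_zmod_eq hnψ ?_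
      rw [Int.cast_natCast, h1, Int.cast_neg, Int.cast_one]
    · right
      intro a ha
      rw [haℓ]
      refine hinv (Or.inr rfl) ?_
      rw [← hval h𝔓 hσ₁ ha]
      refine norm_sub_intCast_lt_one_of_zmod_eq hnψ ?_
      rw [Int.cast_natCast, h1, Int.cast_mul, Int.cast_neg, Int.cast_one, neg_one_mul, Int.cast_natCast]

end Summit.BirchSwinnertonDyer.BirchSwinnertonDyer.Theorems.GoodLatticeKrizPlacementDichotomyRat

end
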